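import Summits.CriticalPhenomena.PercolationContinuityZ3.Theorems.SahiMasterFamilyPointwiseTransfer

/-!
# Principal-cap certificates as DATA: one abstract theorem for `F(k)` and one for the zero transfer, every order

Unit `prim-master-conj` (crux anchor stmt-CriticalPhenomena-4575, helper work), gen 13; memo POINTWISE.md §14.  Seat P4's certificates for `F(k)`
(`PrincipalCapBeta.PhiNonneg k`; k = 6: 872 products in 22 files, k = 7: 22 050 products, exact but not yet in the kernel) are positive rational combinations
of products of the atoms `β_S`, `1 − β_S`, `β_S − β_Aβ_B` (`A ∪ B = S`) summing to `Φ_k(β) + C·(1 − β_⊤)`.  This file fixes the certificate FORMAT as a Lean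
datum and proves the two consumers ONCE for every order, so that an order-`k` certificate costs one data file plus one proof of the expansion identity
(by a reflective checker / `native_decide`, to be supplied):
* `CertAtom k`, `CertAtom.eval`, `CertAtom.wf`; `Cert k := List (ℚ × List (CertAtom k))`, `Cert.eval`, `Cert.wf` (Boolean: non-negative coefficients,
  well-formed gaps — checkable by evaluation);
* `Cert.eval_nonneg` — on an admissible `β` (values in `[0,1]`, supermultiplicative) a well-formed certificate evaluates to `≥ 0`;
* `Cert.eval_transfer` — if the atoms transfer from `β` to `β'` (the hypotheses of `…PointwiseTransfer`), so does `Cert.eval` (closure under `+`, `·`);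
* **`phiNonneg_of_cert`**: a well-formed certificate with `∀ β, c.eval β = Φ_k(β) + C(1 − β_⊤)` proves `PhiNonneg k` (P4's `F(k)`);
* **`phiTransfer_of_cert`**: the same data proves the transfer hypothesis `PT k` of `Pointwise.sahiE_ind_eq_zero_iff_of_principalCap_of_phiTransfer`, hence
  pointwise (EQ-k) on principal caps, on (shared-)face-vanishing `k`-families (`…SharedFaceVanishingAllOrders`) and on their absorbing extensions.
Nothing is asserted about the existence of certificates; axioms standard. [this work]
-/

noncomputable section

open scoped Classical

namespace Summit.CriticalPhenomena.PercolationContinuityZ3.Theorems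

open Finset Function
open Literature.Combinatorics.Sahi2008
open Literature.Probability.Percolation.DecisionTree (ind)
open PrincipalCapBeta

namespace Pointwise

/-! ### 1. Certificates as data -/

/-- The three kinds of atoms of a principal-cap certificate at order `k`: `β_S`, `1 − β_S`, and the Harris gap `β_S − β_A β_B`. [this work] -/
inductive CertAtom (k : ℕ)
  | base (S : Finset (Fin k))
  | defect (S : Finset (Fin k))
  | gap (S A B : Finset (Fin k))

variable {k : ℕ}

/-- The value of an atom at a set function `β`. [this work] -/
def CertAtom.eval (β : Finset (Fin k) → ℝ) : CertAtom k → ℝ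
  | .base S => β S
  | .defect S => 1 - β S
  | .gap S A B => β S - β A * β B

/-- Well-formedness of an atom (a Boolean test, so that certificates can be checked by evaluation): a gap atom must come from a cover `A ∪ B = S`.
[this work] -/
def CertAtom.wf : CertAtom k → Bool
  | .gap S A B => decide (A ∪ B = S)
  | _ => true

/-- A certificate: a list of terms `(q, [a₁, …, a_m])` standing for `q · a₁ ⋯ a_m`. [this work] -/
abbrev Cert (k : ℕ) := List (ℚ × List (CertAtom k))

/-- The value of a product of atoms. [this work] -/
def Cert.prodEval (β : Finset (Fin k) → ℝ) : List (CertAtom k) → ℝ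
  | [] => 1
  | a :: as => a.eval β * Cert.prodEval β as

/-- The value of a certificate. [this work] -/
def Cert.eval (β : Finset (Fin k) → ℝ) : Cert k → ℝ
  | [] => 0
  | t :: rest => (t.1 : ℝ) * Cert.prodEval β t.2 + Cert.eval β rest

/-- Well-formedness of a certificate (Boolean): non-negative coefficients and well-formed atoms. [this work] -/
def Cert.wf (c : Cert k) : Bool := c.all fun t => decide (0 ≤ t.1) && t.2.all CertAtom.wf

/-- Unpacking `Cert.wf`. [this work] -/
theorem Cert.wf_iff (c : Cert k) : Cert.wf c = true ↔ ∀ t ∈ c, 0 ≤ t.1 ∧ ∀ a ∈ t.2, a.wf = true := by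
  unfold Cert.wf
  simp only [List.all_eq_true, Bool.and_eq_true, decide_eq_true_eq]

/-! ### 2. Evaluation: non-negativity and transfer -/

/-- Atoms are non-negative on admissible set functions. [this work] -/
theorem CertAtom.eval_nonneg {β : Finset (Fin k) → ℝ} (h0 : ∀ B, 0 ≤ β B) (h1 : ∀ B, β B ≤ 1)
    (hsup : ∀ S T, β S * β T ≤ β (S ∪ T)) : ∀ a : CertAtom k, a.wf = true → 0 ≤ a.eval β
  | .base S, _ => h0 S
  | .defect S, _ => sub_nonneg.2 (h1 S)
  | .gap S A B, hw => by
    have hw' : A ∪ B = S := of_decide_eq_true hw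
    change 0 ≤ β S - β A * β B
    rw [← hw']; exact sub_nonneg.2 (hsup A B)

/-- Products of well-formed atoms are non-negative on admissible set functions. [this work] -/
theorem Cert.prodEval_nonneg {β : Finset (Fin k) → ℝ} (h0 : ∀ B, 0 ≤ β B) (h1 : ∀ B, β B ≤ 1)
    (hsup : ∀ S T, β S * β T ≤ β (S ∪ T)) : ∀ as : List (CertAtom k), (∀ a ∈ as, a.wf = true) → 0 ≤ Cert.prodEval β as
  | [], _ => zero_le_one
  | a :: as, hw => mul_nonneg (CertAtom.eval_nonneg h0 h1 hsup a (hw a (by simp)))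
      (Cert.prodEval_nonneg h0 h1 hsup as fun b hb => hw b (by simp [hb]))

/-- **A well-formed certificate is non-negative on every admissible set function.** [this work] -/
theorem Cert.eval_nonneg {β : Finset (Fin k) → ℝ} (h0 : ∀ B, 0 ≤ β B) (h1 : ∀ B, β B ≤ 1)
    (hsup : ∀ S T, β S * β T ≤ β (S ∪ T)) : ∀ c : Cert k, Cert.wf c = true → 0 ≤ Cert.eval β c
  | [], _ => le_rfl
  | t :: rest, hw => by
    rw [Cert.wf_iff] at hw
    have ht := hw t (by simp)
    exact add_nonneg (mul_nonneg (by exact_mod_cast ht.1) (Cert.prodEval_nonneg h0 h1 hsup t.2 ht.2))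
      (Cert.eval_nonneg h0 h1 hsup rest ((Cert.wf_iff rest).2 fun s hs => hw s (by simp [hs])))

/-- Atoms transfer (by hypothesis, one kind at a time). [this work] -/
theorem CertAtom.eval_transfer {β β' : Finset (Fin k) → ℝ}
    (hb : ∀ B, 0 ≤ β B ∧ 0 ≤ β' B ∧ (β B = 0 → β' B = 0))
    (hd : ∀ B, 0 ≤ 1 - β B ∧ 0 ≤ 1 - β' B ∧ (1 - β B = 0 → 1 - β' B = 0))
    (hg : ∀ S A B : Finset (Fin k), A ∪ B = S →
      0 ≤ β S - β A * β B ∧ 0 ≤ β' S - β' A * β' B ∧ (β S - β A * β B = 0 → β' S - β' A * β' B = 0)) :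
    ∀ a : CertAtom k, a.wf = true → 0 ≤ a.eval β ∧ 0 ≤ a.eval β' ∧ (a.eval β = 0 → a.eval β' = 0)
  | .base S, _ => hb S
  | .defect S, _ => hd S
  | .gap S A B, hw => hg S A B (of_decide_eq_true hw)

/-- Products of atoms transfer. [this work] -/
theorem Cert.prodEval_transfer {β β' : Finset (Fin k) → ℝ}
    (hb : ∀ B, 0 ≤ β B ∧ 0 ≤ β' B ∧ (β B = 0 → β' B = 0))
    (hd : ∀ B, 0 ≤ 1 - β B ∧ 0 ≤ 1 - β' B ∧ (1 - β B = 0 → 1 - β' B = 0))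
    (hg : ∀ S A B : Finset (Fin k), A ∪ B = S →
      0 ≤ β S - β A * β B ∧ 0 ≤ β' S - β' A * β' B ∧ (β S - β A * β B = 0 → β' S - β' A * β' B = 0)) :
    ∀ as : List (CertAtom k), (∀ a ∈ as, a.wf = true) →
      0 ≤ Cert.prodEval β as ∧ 0 ≤ Cert.prodEval β' as ∧ (Cert.prodEval β as = 0 → Cert.prodEval β' as = 0)
  | [], _ => tr_const zero_le_one
  | a :: as, hw => tr_mul (CertAtom.eval_transfer hb hd hg a (hw a (by simp)))
      (Cert.prodEval_transfer hb hd hg as fun b hb' => hw b (by simp [hb']))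

/-- **Certificates transfer**: if the atoms transfer from `β` to `β'`, a well-formed certificate is `≥ 0` at both and vanishes at `β'` if it vanishes at `β`.
[this work] -/
theorem Cert.eval_transfer {β β' : Finset (Fin k) → ℝ}
    (hb : ∀ B, 0 ≤ β B ∧ 0 ≤ β' B ∧ (β B = 0 → β' B = 0))
    (hd : ∀ B, 0 ≤ 1 - β B ∧ 0 ≤ 1 - β' B ∧ (1 - β B = 0 → 1 - β' B = 0))
    (hg : ∀ S A B : Finset (Fin k), A ∪ B = S →
      0 ≤ β S - β A * β B ∧ 0 ≤ β' S - β' A * β' B ∧ (β S - β A * β B = 0 → β' S - β' A * β' B = 0)) :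
    ∀ c : Cert k, Cert.wf c = true → 0 ≤ Cert.eval β c ∧ 0 ≤ Cert.eval β' c ∧ (Cert.eval β c = 0 → Cert.eval β' c = 0)
  | [], _ => tr_const le_rfl
  | t :: rest, hw => by
    rw [Cert.wf_iff] at hw
    have ht := hw t (by simp)
    exact tr_add (tr_mul (tr_const (by exact_mod_cast ht.1)) (Cert.prodEval_transfer hb hd hg t.2 ht.2))
      (Cert.eval_transfer hb hd hg rest ((Cert.wf_iff rest).2 fun s hs => hw s (by simp [hs])))

/-! ### 3. The two consumers, every order -/

/-- **`F(k)` from a certificate**: a well-formed certificate expanding to `Φ_k + C(1 − β_⊤)` proves `PhiNonneg k`. [this work] -/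
theorem phiNonneg_of_cert (c : Cert k) (hc : Cert.wf c = true) (C : ℝ) (hid : ∀ β : Finset (Fin k) → ℝ, Cert.eval β c = phiSet k β + C * (1 - β univ)) :
    PhiNonneg k := by
  intro β h0 h1 htop hsup
  have h := Cert.eval_nonneg h0 h1 hsup c hc
  rw [hid β, htop, sub_self, mul_zero, add_zero] at h
  exact h

/-- **The zero transfer `PT k` from a certificate**: the same data proves the hypothesis of
`Pointwise.sahiE_ind_eq_zero_iff_of_principalCap_of_phiTransfer` (hence pointwise (EQ-k) on principal caps and on the (shared-)face-vanishing class).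
[this work] -/
theorem phiTransfer_of_cert (c : Cert k) (hc : Cert.wf c = true) (C : ℝ) (hid : ∀ β : Finset (Fin k) → ℝ, Cert.eval β c = phiSet k β + C * (1 - β univ)) :
    ∀ β β' : Finset (Fin k) → ℝ, β univ = 1 → β' univ = 1 →
      (∀ B, 0 ≤ β B ∧ 0 ≤ β' B ∧ (β B = 0 → β' B = 0)) →
      (∀ B, 0 ≤ 1 - β B ∧ 0 ≤ 1 - β' B ∧ (1 - β B = 0 → 1 - β' B = 0)) →
      (∀ S A B : Finset (Fin k), A ∪ B = S →
        0 ≤ β S - β A * β B ∧ 0 ≤ β' S - β' A * β' B ∧ (β S - β A * β B = 0 → β' S - β' A * β' B = 0)) →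
      phiSet k β = 0 → phiSet k β' = 0 := by
  intro β β' htop htop' hb hd hg hz
  have T := Cert.eval_transfer hb hd hg c hc
  have e : Cert.eval β c = phiSet k β := by rw [hid β, htop, sub_self, mul_zero, add_zero]
  have e' : Cert.eval β' c = phiSet k β' := by rw [hid β', htop', sub_self, mul_zero, add_zero]
  rw [← e', ← T.2.2 (by rw [e, hz])]

/-- **Pointwise (EQ-(k+1)) on the principal-cap stratum from a certificate** (every order). [this work] -/
theorem sahiE_ind_eq_zero_iff_of_principalCap_of_cert {ι : Type} [Fintype ι] (c : Cert (k + 1)) (hc : Cert.wf c = true) (C : ℝ)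
    (hid : ∀ β : Finset (Fin (k + 1)) → ℝ, Cert.eval β c = phiSet (k + 1) β + C * (1 - β univ))
    {p : ι → unitInterval} (hp : ∀ e, (p e : ℝ) ∈ Set.Ioo (0 : ℝ) 1) (U : Fin (k + 1) → Set (Set ι))
    (hU : ∀ j, IsUpperSet (U j)) (c₀ : Finset ι) (hpc : ∀ T : Set ι, (∀ j, T ∈ U j) ↔ (↑c₀ : Set ι) ⊆ T) :
    sahiE (bernoulliWeight p) (k + 1) (fun j => ind (U j)) = 0 ↔ SuppZeroFlag (k + 1) U :=
  sahiE_ind_eq_zero_iff_of_principalCap_of_phiTransfer (phiTransfer_of_cert c hc C hid) hp U hU c₀ hpc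

/-- **`C_{k+1}` on the principal-cap stratum from a certificate** (every order; P4's reduction). [this work] -/
theorem sahiE_ind_nonneg_of_principalCap_of_cert {ι : Type} [Fintype ι] (c : Cert (k + 1)) (hc : Cert.wf c = true) (C : ℝ)
    (hid : ∀ β : Finset (Fin (k + 1)) → ℝ, Cert.eval β c = phiSet (k + 1) β + C * (1 - β univ))
    (p : ι → unitInterval) (U : Fin (k + 1) → Set (Set ι)) (hU : ∀ j, IsUpperSet (U j)) (c₀ : Finset ι)
    (hpc : ∀ T : Set ι, (∀ j, T ∈ U j) ↔ (↑c₀ : Set ι) ⊆ T) :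
    0 ≤ sahiE (bernoulliWeight p) (k + 1) (fun j => ind (U j)) :=
  sahiE_ind_nonneg_of_phiNonneg (phiNonneg_of_cert c hc C hid) p U hU c₀ hpc

end Pointwise

end Summit.CriticalPhenomena.PercolationContinuityZ3.Theorems
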